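import Summits.ValiantsHypothesis.ValiantsHypothesis.Theorems.SymPencilPerFourInnerRankNineHyperplaneFamily

/-!
# Route `SymPencil` — inner rank on hyperplanes, III: the family alternative holds UNIFORMLY on
# the section of the base family by `U'` (IR9U programme; `--supports` stmt-ValiantsHypothesis-5674
# `SdcSuperquadratic`; rung currency only — nothing here bears on `VP ≠ VNP`)

`SymPencilPerFourInnerRankFamily.family₂₃` (val-width-5674-p2 g2) upgrades the pointwise family
step to an identity on the WHOLE `6`-dimensional base family `F₂₃ = {(a, b) : b ∈ span(e₂, e₃)}`
by polynomiality along lines (`SymPencilPerFourHessianMinors.forall_eq_zero_or_of_mul₃`, which is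
stated for an arbitrary submodule of the parameter space).  In the `u`-restricted setting IR9U the
identity holds for `u ∈ U'` only; with `SymPencilPerFourInnerRankNineHyperplaneFamily.family_step_U`
(derivative direction `δ ∈ U'`) the same argument on the SECTION `S = {z : (a(z), b(z)) ∈ U'}`
gives (`family₂₃_U`): either `t_r(u, (k(b), 0)) = 0` for all `u = (a,b) ∈ F₂₃ ∩ U'`, or
`t_r(u, (0, k(b))) = 0` for all of them, OR the section is DEGENERATE for the chosen `δ`: the
polynomial `a₀ a₁ b₂ b₃ (a₂ b₃ + a₃ b₂) · (a₀ δ.2 1 + a₁ δ.2 0)` vanishes identically on it (the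
residual case (R1)/(R3) of the blueprint `HOME(val-lit)/NOTE-port4g2-CELL-NINE-SEVEN.md` §6, to be
excluded by the choice of `δ` and the quadric/section lemma).

Honest framing: a lemma of the IR9U programme; IR9U/IR9H and the cell `(9,7,8)` stay
OPEN/conditional; window `27 ≤ sdc(per₄) ≤ 29` UNCHANGED; `VP ≠ VNP` not moved; no summit
statement is proved here.  No definitions, no named facts. [folklore]
-/

noncomputable section

-- single-conjunct layout: Sub = Summit, duplicated namespace component intended
set_option linter.dupNamespace false

namespace Summit.ValiantsHypothesis.ValiantsHypothesis.Theorems.SymPencilPerFourInnerRankNineHyperplaneUniform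

open Matrix Finset Module Polynomial
open Summit.ValiantsHypothesis.ValiantsHypothesis.Theorems.SymPencilPerFourHessianMinors
open Summit.ValiantsHypothesis.ValiantsHypothesis.Theorems.SymPencilPerFourInnerRankRows
open Summit.ValiantsHypothesis.ValiantsHypothesis.Theorems.SymPencilPerFourInnerRankNineHyperplaneFamily

variable {K : Type*} [Field K]

/-- **The family alternative on the section by `U'`.**  See the module docstring. [folklore] -/
theorem family₂₃_U [CharZero K] (U' : Submodule K ((Fin 4 → K) × (Fin 4 → K)))
    (c : Fin 8 → K) (hc : ∀ r, c r ≠ 0)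
    (t : Fin 8 → (((Fin 4 → K) × (Fin 4 → K)) →ₗ[K] ((Fin 4 → K) × (Fin 4 → K)) →ₗ[K] K))
    (hJ : ∀ u ∈ U', ∀ y₂ y₃ : Fin 4 → K,
      ∑ r, c r * (t r u (y₂, y₃)) ^ 2 = (Matrix.of ![u.1, u.2, y₂, y₃]).permanent)
    (δ : (Fin 4 → K) × (Fin 4 → K)) (hδ : δ ∈ U') :
    (∀ (a b : Fin 4 → K), b 0 = 0 → b 1 = 0 →
        ((a, b) : (Fin 4 → K) × (Fin 4 → K)) ∈ U' → ∀ r,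
        t r (a, b) (b 2 • Pi.single (2 : Fin 4) (1 : K) - b 3 • Pi.single 3 1, 0) = 0) ∨
    (∀ (a b : Fin 4 → K), b 0 = 0 → b 1 = 0 →
        ((a, b) : (Fin 4 → K) × (Fin 4 → K)) ∈ U' → ∀ r,
        t r (a, b) (0, b 2 • Pi.single (2 : Fin 4) (1 : K) - b 3 • Pi.single 3 1) = 0) ∨
    (∀ (a b : Fin 4 → K), b 0 = 0 → b 1 = 0 →
        ((a, b) : (Fin 4 → K) × (Fin 4 → K)) ∈ U' →
        a 0 * a 1 * b 2 * b 3 * (a 2 * b 3 + a 3 * b 2) * (a 0 * δ.2 1 + a 1 * δ.2 0) = 0) := by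
  -- linear parametrisation of the family by `P = (Fin 4 → K) × (K × K)`
  let L : (K × K) →ₗ[K] (Fin 4 → K) :=
    (LinearMap.fst K K K).smulRight (Pi.single 2 1) + (LinearMap.snd K K K).smulRight (Pi.single 3 1)
  let L' : (K × K) →ₗ[K] (Fin 4 → K) :=
    (LinearMap.fst K K K).smulRight (Pi.single 2 1) - (LinearMap.snd K K K).smulRight (Pi.single 3 1)
  let φ : ((Fin 4 → K) × (K × K)) →ₗ[K] ((Fin 4 → K) × (Fin 4 → K)) :=
    (LinearMap.fst K (Fin 4 → K) (K × K)).prod (L ∘ₗ LinearMap.snd K (Fin 4 → K) (K × K))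
  let ψ₂ : ((Fin 4 → K) × (K × K)) →ₗ[K] ((Fin 4 → K) × (Fin 4 → K)) :=
    LinearMap.inl K (Fin 4 → K) (Fin 4 → K) ∘ₗ L' ∘ₗ LinearMap.snd K (Fin 4 → K) (K × K)
  let ψ₃ : ((Fin 4 → K) × (K × K)) →ₗ[K] ((Fin 4 → K) × (Fin 4 → K)) :=
    LinearMap.inr K (Fin 4 → K) (Fin 4 → K) ∘ₗ L' ∘ₗ LinearMap.snd K (Fin 4 → K) (K × K)
  have hφ : ∀ z, φ z = (z.1, z.2.1 • Pi.single (2 : Fin 4) (1 : K) + z.2.2 • Pi.single 3 1) :=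
    fun z => rfl
  have hψ₂ : ∀ z, ψ₂ z = (z.2.1 • Pi.single (2 : Fin 4) (1 : K) - z.2.2 • Pi.single 3 1, 0) :=
    fun z => rfl
  have hψ₃ : ∀ z, ψ₃ z = (0, z.2.1 • Pi.single (2 : Fin 4) (1 : K) - z.2.2 • Pi.single 3 1) :=
    fun z => rfl
  -- the section `S = φ⁻¹(U')`
  set S : Submodule K ((Fin 4 → K) × (K × K)) := U'.comap φ with hS
  have hmemS : ∀ z, z ∈ S ↔ φ z ∈ U' := fun z => Submodule.mem_comap
  let f : Fin 8 → ((Fin 4 → K) × (K × K)) → K := fun r z => t r (φ z) (ψ₂ z)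
  let g : Fin 8 → ((Fin 4 → K) × (K × K)) → K := fun r z => t r (φ z) (ψ₃ z)
  let h : ((Fin 4 → K) × (K × K)) → K := fun z =>
    z.1 0 * z.1 1 * z.2.1 * z.2.2 * (z.1 2 * z.2.2 + z.1 3 * z.2.1) * (z.1 0 * δ.2 1 + z.1 1 * δ.2 0)
  -- `h` is polynomial along lines (degree `6`)
  have hdef : ∀ z, h z = z.1 0 * z.1 1 * z.2.1 * z.2.2 * (z.1 2 * z.2.2 + z.1 3 * z.2.1) *
      (z.1 0 * δ.2 1 + z.1 1 * δ.2 0) := fun z => rfl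
  have hh : ∀ z₀ z : (Fin 4 → K) × (K × K), ∃ p : K[X], ∀ s : K, h (z₀ + s • z) = p.eval s := by
    intro z₀ z
    refine ⟨(Polynomial.C (z₀.1 0) + Polynomial.C (z.1 0) * Polynomial.X) *
        (Polynomial.C (z₀.1 1) + Polynomial.C (z.1 1) * Polynomial.X) *
        (Polynomial.C z₀.2.1 + Polynomial.C z.2.1 * Polynomial.X) *
        (Polynomial.C z₀.2.2 + Polynomial.C z.2.2 * Polynomial.X) *
        ((Polynomial.C (z₀.1 2) + Polynomial.C (z.1 2) * Polynomial.X) *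
            (Polynomial.C z₀.2.2 + Polynomial.C z.2.2 * Polynomial.X) +
          (Polynomial.C (z₀.1 3) + Polynomial.C (z.1 3) * Polynomial.X) *
            (Polynomial.C z₀.2.1 + Polynomial.C z.2.1 * Polynomial.X)) *
        (Polynomial.C (z₀.1 0 * δ.2 1 + z₀.1 1 * δ.2 0) +
          Polynomial.C (z.1 0 * δ.2 1 + z.1 1 * δ.2 0) * Polynomial.X), fun s => ?_⟩
    rw [hdef]
    simp only [Prod.fst_add, Prod.snd_add, Prod.smul_fst, Prod.smul_snd, Pi.add_apply,
      Pi.smul_apply, smul_eq_mul, Polynomial.eval_add, Polynomial.eval_mul, Polynomial.eval_C,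
      Polynomial.eval_X]
    ring
  have key : ∀ r r', (∀ z ∈ S, f r z = 0) ∨ (∀ z ∈ S, g r' z = 0) ∨ (∀ z ∈ S, h z = 0) := by
    intro r r'
    exact forall_eq_zero_or_of_mul₃ S (f := f r) (g := g r') (h := h)
      (linePoly_bilin (t r) φ ψ₂) (linePoly_bilin (t r') φ ψ₃) hh (by
        intro z hz
        by_cases hz0 : h z = 0
        · rw [hz0, mul_zero]
        · have hz1 : z.1 0 * z.1 1 * z.2.1 * z.2.2 * (z.1 2 * z.2.2 + z.1 3 * z.2.1) ≠ 0 :=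
            fun h0 => hz0 (by rw [hdef, h0, zero_mul])
          have hz2 : z.1 0 * δ.2 1 + z.1 1 * δ.2 0 ≠ 0 :=
            fun h0 => hz0 (by rw [hdef, h0, mul_zero])
          rcases family_step_U U' c hc t hJ z.1 z.2.1 z.2.2 ((hmemS z).1 hz) hz1 δ hδ hz2 with
            H | H
          · rw [show f r z = 0 from H r, zero_mul, zero_mul]
          · rw [show g r' z = 0 from H r', mul_zero, zero_mul])
  -- unpack
  by_cases hH : ∀ z ∈ S, h z = 0
  · right; right
    intro a b hb0 hb1 hab
    have hz : ((a, (b 2, b 3)) : (Fin 4 → K) × (K × K)) ∈ S := by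
      rw [hmemS, hφ]
      simp only
      rwa [← eq_single_add_single b hb0 hb1]
    exact hH _ hz
  push Not at hH
  obtain ⟨z₀, hz₀S, hz₀⟩ := hH
  by_cases hB : ∀ r', ∀ z ∈ S, g r' z = 0
  · right; left
    intro a b hb0 hb1 hab r
    have hz : ((a, (b 2, b 3)) : (Fin 4 → K) × (K × K)) ∈ S := by
      rw [hmemS, hφ]
      simp only
      rwa [← eq_single_add_single b hb0 hb1]
    have := hB r _ hz
    simp only [g, hφ, hψ₃] at this
    rwa [← eq_single_add_single b hb0 hb1] at this
  · push Not at hB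
    obtain ⟨r', z', hz'S, hz'⟩ := hB
    left
    intro a b hb0 hb1 hab r
    have hz : ((a, (b 2, b 3)) : (Fin 4 → K) × (K × K)) ∈ S := by
      rw [hmemS, hφ]
      simp only
      rwa [← eq_single_add_single b hb0 hb1]
    rcases key r r' with H | H | H
    · have := H _ hz
      simp only [f, hφ, hψ₂] at this
      rwa [← eq_single_add_single b hb0 hb1] at this
    · exact absurd (H z' hz'S) hz'
    · exact absurd (H z₀ hz₀S) hz₀

end Summit.ValiantsHypothesis.ValiantsHypothesis.Theorems.SymPencilPerFourInnerRankNineHyperplaneUniform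

end
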